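import Summits.Ventures.PercRepro.S1PoorCapSeven

/-!
# PercRepro — CASE 1 PARAMETRIC BY DELETION AND AVERAGING, AND THE PER-POINT FIVE-CIRCUIT CAP `q₇ ≤ 66` AT NULLITY `7` (p1, gen 35)

`proofs/P1-S2-CORANK6.md` §4p. On a spread e-free core of nullity `d' + 3` with a 7-point rank-`4` flat `S₀` through `e` whose six
other points are NON-coloops, the double count of §4l addendum 7 reads: a circuit inside `S₀` meets `S₀ ∖ {e}` in `4` points (`≤ 15` of
them), one outside in `≤ 1` point (`≤ C(d' + 3, 4) + 2·C(d' + 2, 3)` of them, the classes (α) and (β)), so some `s ∈ S₀ ∖ {e}` lies on at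
most `⌊(60 + C(d' + 3, 4) + 2·C(d' + 2, 3))/6⌋` of the five-circuits through `e`; deleting `s` leaves a spread e-free core of nullity
`d' + 2`, whose five-circuits through `e` number at most the per-point cap `q` there
(**`ncard_fiveCircuitsThrough_le_of_seven_solid_gen_of_nonColoops`**: `≤ q + 15` at `d' = 3`, `≤ q + 22` at `d' = 4`).
COLOOPS cost nothing: deleting a coloop keeps every circuit and the nullity (`nullity_delete_singleton_of_isColoop`,
`fiveCircuitsThrough_delete_eq_of_isColoop`), so the per-point cap at nullity `7` is proved by strong induction on the point count —
a coloop is deleted, and on a coloop-free core the solid split of `S1PoorCapThirteenSix` applies with Case 1 `≤ 44 + 22 = 66` and Case 2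
the total `63` of `S1PoorCapSeven`: **`ncard_fiveCircuitsThrough_le_sixty_six_of_nullity_seven`** — every point of a spread e-free core
of nullity `7` lies on at most `66` five-circuits. Nothing about any cell is claimed. Axioms: standard.
-/

open scoped Matroid

namespace PercRepro

namespace S1

open Set

open FourCap

variable {α : Type}

/-- **Deleting a coloop keeps the nullity** (`M ／ {s} = M ＼ {s}` for a coloop `s`, and contracting a non-loop keeps the nullity). -/
theorem nullity_delete_singleton_of_isColoop (M : Matroid α) [M.Finite] {s : α} (hs : M.IsColoop s) {d : ℕ}
    (hd : M.E.encard = M.eRank + d) : (M ＼ {s}).E.encard = (M ＼ {s}).eRank + d := by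
  have hcd : M ／ {s} = M ＼ {s} :=
    Matroid.contract_eq_delete_of_subset_coloops (singleton_subset_iff.2 (Matroid.isColoop_iff_mem_coloops.1 hs))
  rw [← hcd]
  exact nullity_contract_singleton_of_not_isLoop M hs.mem_ground hs.isNonloop.not_isLoop hd

/-- **Deleting a coloop keeps the five-circuits through `e`** (no circuit contains a coloop). -/
theorem fiveCircuitsThrough_delete_eq_of_isColoop (M : Matroid α) {s : α} (hs : M.IsColoop s) (e : α) :
    {C : Set α | (M ＼ {s}).IsCircuit C ∧ C.ncard = 5 ∧ e ∈ C} = {C : Set α | M.IsCircuit C ∧ C.ncard = 5 ∧ e ∈ C} := by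
  ext C
  simp only [mem_setOf_eq, Matroid.delete_isCircuit_iff]
  constructor
  · rintro ⟨⟨hC, -⟩, h5, heC⟩; exact ⟨hC, h5, heC⟩
  · rintro ⟨hC, h5, heC⟩
    exact ⟨⟨hC, disjoint_singleton_right.2 (hs.notMem_isCircuit hC)⟩, h5, heC⟩

/-- **CASE 1 AT NULLITY `d' + 3` BY DELETION AND AVERAGING, ALL SIX OTHER POINTS OF THE FLAT NON-COLOOPS**:
`≤ q + ⌊(60 + C(d' + 3, 4) + 2·C(d' + 2, 3))/6⌋` five-circuits through `e`, where `q` bounds the five-circuits through any point of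
any spread e-free core of nullity `d' + 2`. -/
theorem ncard_fiveCircuitsThrough_le_of_seven_solid_gen_of_nonColoops (M : Matroid α) [M.Finite] (d' : ℕ)
    (hfree : ∀ e ∈ M.E, ∃ A ⊆ M.E \ {e}, e ∉ M.closure A ∧ e ∉ M.closure ((M.E \ {e}) \ A))
    (hns : ¬ ∃ W ⊆ M.E, W.ncard ≤ 9 ∧ W.encard = M.eRk W + 4) (hd : M.E.encard = M.eRank + (d' + 3))
    {e : α} {X : Set α} (hX4 : M.eRk X = 4) (heX : e ∈ M.closure X) (h7 : (M.closure X).ncard = 7)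
    (hcol : ∀ s ∈ M.closure X \ {e}, ¬ M.IsColoop s) (q : ℕ)
    (hq : ∀ (M' : Matroid α) [M'.Finite],
      (∀ e ∈ M'.E, ∃ A ⊆ M'.E \ {e}, e ∉ M'.closure A ∧ e ∉ M'.closure ((M'.E \ {e}) \ A)) →
      (¬ ∃ W ⊆ M'.E, W.ncard ≤ 9 ∧ W.encard = M'.eRk W + 4) → M'.E.encard = M'.eRank + (d' + 2) → ∀ e' ∈ M'.E,
      {C : Set α | M'.IsCircuit C ∧ C.ncard = 5 ∧ e' ∈ C}.ncard ≤ q) :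
    {C : Set α | M.IsCircuit C ∧ C.ncard = 5 ∧ e ∈ C}.ncard ≤
      q + (60 + (d' + 3).choose 4 + 2 * (d' + 2).choose (2 + 1)) / 6 := by
  classical
  have hS₀E : M.closure X ⊆ M.E := M.closure_subset_ground X
  have hS₀f : (M.closure X).Finite := M.ground_finite.subset hS₀E
  have heE : e ∈ M.E := hS₀E heX
  have hS₀e : (M.closure X \ {e}).ncard = 6 := by rw [ncard_sdiff_singleton_of_mem heX, h7]
  have hfinsub : ∀ s : Set (Set α), (∀ C ∈ s, M.IsCircuit C) → s.Finite := fun s hs =>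
    M.ground_finite.finite_subsets.subset (fun C hC => (hs C hC).subset_ground)
  -- the classes (α) and (β)
  have hα := ncard_fiveCircuitsThrough_inter_subset_le_choose_gen M d' hfree hd hX4 heX h7
  have hβ := ncard_fiveCircuitsThrough_inter_pair_le_gen M d' hfree hns hd hX4 heX h7
  have hin15 : {C : Set α | M.IsCircuit C ∧ C.ncard = 5 ∧ e ∈ C ∧ C ⊆ M.closure X}.ncard ≤ 15 := by
    have := ncard_fiveCircuitsThrough_subset_le_choose M hS₀E e
    rw [hS₀e] at this
    exact this.trans (le_of_eq (by decide))
  have hS'f : (M.closure X \ {e}).Finite := hS₀f.subset sdiff_subset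
  have h𝒞f : {C : Set α | M.IsCircuit C ∧ C.ncard = 5 ∧ e ∈ C}.Finite := hfinsub _ (fun C hC => hC.1)
  -- the double count: `Σ_C |C ∩ S'| = Σ_s deg(s)`
  have hdc := Finset.sum_card_bipartiteAbove_eq_sum_card_bipartiteBelow (r := fun (C : Set α) (s : α) => s ∈ C)
    (s := h𝒞f.toFinset) (t := hS'f.toFinset)
  -- each circuit contributes `≤ 4` (inside) or `≤ 1` (outside)
  have hrow : ∀ C ∈ h𝒞f.toFinset, (hS'f.toFinset.bipartiteAbove (fun (C : Set α) (s : α) => s ∈ C) C).card ≤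
      if C ⊆ M.closure X then 4 else 1 := by
    intro C hC
    rw [Finite.mem_toFinset] at hC
    have hcoe : ((hS'f.toFinset.bipartiteAbove (fun (C : Set α) (s : α) => s ∈ C) C : Finset α) : Set α) =
        (M.closure X \ {e}) ∩ C := by
      rw [Finset.bipartiteAbove, Finset.coe_filter]
      ext x
      simp only [mem_setOf_eq, Finite.mem_toFinset, mem_inter_iff]
    rw [← ncard_coe_finset, hcoe]
    by_cases hCS : C ⊆ M.closure X
    · rw [if_pos hCS]
      have : (M.closure X \ {e}) ∩ C = C \ {e} := by
        ext x
        constructor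
        · rintro ⟨⟨_, hxe⟩, hxC⟩; exact ⟨hxC, hxe⟩
        · rintro ⟨hxC, hxe⟩; exact ⟨⟨hCS hxC, hxe⟩, hxC⟩
      rw [this, ncard_sdiff_singleton_of_mem hC.2.2, hC.2.1]
    · rw [if_neg hCS]
      have h2 := ncard_inter_le_two_of_not_subset M hns hX4 h7 hC.1 hC.2.1 hCS
      have : (M.closure X \ {e}) ∩ C = (C ∩ M.closure X) \ {e} := by
        ext x
        constructor
        · rintro ⟨⟨hxS, hxe⟩, hxC⟩; exact ⟨⟨hxC, hxS⟩, hxe⟩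
        · rintro ⟨⟨hxC, hxS⟩, hxe⟩; exact ⟨⟨hxS, hxe⟩, hxC⟩
      rw [this, ncard_sdiff_singleton_of_mem (show e ∈ C ∩ M.closure X from ⟨hC.2.2, heX⟩)]
      omega
  have hsum : ∑ s ∈ hS'f.toFinset, (h𝒞f.toFinset.bipartiteBelow (fun (C : Set α) (s : α) => s ∈ C) s).card ≤
      60 + (d' + 3).choose 4 + 2 * (d' + 2).choose (2 + 1) := by
    rw [← hdc]
    calc ∑ C ∈ h𝒞f.toFinset, (hS'f.toFinset.bipartiteAbove (fun (C : Set α) (s : α) => s ∈ C) C).card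
        ≤ ∑ C ∈ h𝒞f.toFinset, (if C ⊆ M.closure X then 4 else 1) := Finset.sum_le_sum hrow
      _ = 4 * (h𝒞f.toFinset.filter (fun C => C ⊆ M.closure X)).card +
          (h𝒞f.toFinset.filter (fun C => ¬ C ⊆ M.closure X)).card := by
          rw [Finset.sum_ite, Finset.sum_const, Finset.sum_const, smul_eq_mul, smul_eq_mul, mul_one, mul_comm]
      _ ≤ 4 * 15 + ((d' + 3).choose 4 + 2 * (d' + 2).choose (2 + 1)) := by
          have hA : (h𝒞f.toFinset.filter (fun C => C ⊆ M.closure X)).card ≤ 15 := by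
            rw [← ncard_coe_finset]
            refine (ncard_le_ncard ?_ (hfinsub _ (fun C hC => hC.1))).trans hin15
            intro C hC
            rw [Finset.mem_coe, Finset.mem_filter, Finite.mem_toFinset] at hC
            exact ⟨hC.1.1, hC.1.2.1, hC.1.2.2, hC.2⟩
          have hB : (h𝒞f.toFinset.filter (fun C => ¬ C ⊆ M.closure X)).card ≤
              (d' + 3).choose 4 + 2 * (d' + 2).choose (2 + 1) := by
            rw [← ncard_coe_finset]
            have hsub' : (↑(h𝒞f.toFinset.filter (fun C => ¬ C ⊆ M.closure X)) : Set (Set α)) ⊆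
                {C : Set α | M.IsCircuit C ∧ C.ncard = 5 ∧ e ∈ C ∧ C ∩ M.closure X ⊆ {e}} ∪
                  {C : Set α | M.IsCircuit C ∧ C.ncard = 5 ∧ e ∈ C ∧ ¬ C ⊆ M.closure X ∧
                    ¬ C ∩ M.closure X ⊆ {e}} := by
              intro C hC
              rw [Finset.mem_coe, Finset.mem_filter, Finite.mem_toFinset] at hC
              by_cases h2 : C ∩ M.closure X ⊆ {e}
              · exact Or.inl ⟨hC.1.1, hC.1.2.1, hC.1.2.2, h2⟩
              · exact Or.inr ⟨hC.1.1, hC.1.2.1, hC.1.2.2, hC.2, h2⟩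
            have := ncard_le_ncard hsub' ((hfinsub _ (fun C hC => hC.1)).union (hfinsub _ (fun C hC => hC.1)))
            have h' := ncard_union_le {C : Set α | M.IsCircuit C ∧ C.ncard = 5 ∧ e ∈ C ∧ C ∩ M.closure X ⊆ {e}}
              {C : Set α | M.IsCircuit C ∧ C.ncard = 5 ∧ e ∈ C ∧ ¬ C ⊆ M.closure X ∧ ¬ C ∩ M.closure X ⊆ {e}}
            omega
          omega
      _ = 60 + (d' + 3).choose 4 + 2 * (d' + 2).choose (2 + 1) := by ring
  -- pigeonhole over the six points of `S₀ ∖ {e}`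
  have hcard6 : hS'f.toFinset.card = 6 := by rw [← ncard_eq_toFinset_card _ hS'f, hS₀e]
  have hex : ∃ s ∈ hS'f.toFinset,
      (h𝒞f.toFinset.bipartiteBelow (fun (C : Set α) (s : α) => s ∈ C) s).card <
        (60 + (d' + 3).choose 4 + 2 * (d' + 2).choose (2 + 1)) / 6 + 1 := by
    refine Finset.exists_lt_of_sum_lt ?_
    rw [Finset.sum_const, hcard6, smul_eq_mul]
    omega
  obtain ⟨s, hs, hdeg⟩ := hex
  rw [Finite.mem_toFinset] at hs
  have hsE : s ∈ M.E := hS₀E hs.1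
  have hse : s ≠ e := fun h => hs.2 (mem_singleton_iff.2 h)
  have hdeg' : {C : Set α | M.IsCircuit C ∧ C.ncard = 5 ∧ e ∈ C ∧ s ∈ C}.ncard ≤
      (60 + (d' + 3).choose 4 + 2 * (d' + 2).choose (2 + 1)) / 6 := by
    have hcoe : ((h𝒞f.toFinset.bipartiteBelow (fun (C : Set α) (s : α) => s ∈ C) s : Finset (Set α)) : Set (Set α)) =
        {C : Set α | M.IsCircuit C ∧ C.ncard = 5 ∧ e ∈ C ∧ s ∈ C} := by
      rw [Finset.bipartiteBelow, Finset.coe_filter]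
      ext C
      simp only [mem_setOf_eq, Finite.mem_toFinset]
      tauto
    rw [← hcoe, ncard_coe_finset]
    omega
  -- delete `s`: a spread e-free core of nullity `d' + 2`
  have hnc : ¬ M.IsColoop s := hcol s hs
  have hd' : (M ＼ {s}).E.encard = (M ＼ {s}).eRank + (d' + 2) :=
    nullity_delete_singleton_of_not_isColoop M hsE hnc (d := d' + 2) hd
  have hfree' := S1.hfree_delete M hfree s
  have hns' := spread_delete M hns s
  have heE' : e ∈ (M ＼ {s}).E := by
    rw [Matroid.delete_ground]
    exact ⟨heE, fun h => hse (mem_singleton_iff.1 h).symm⟩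
  have hq' := hq (M ＼ {s}) hfree' hns' hd' e heE'
  have hsplit' := ncard_fiveCircuitsThrough_le_delete_add M e s
  omega

/-- **The per-point five-circuit cap at nullity `7`, by strong induction on the point count**: every point of a spread e-free core of
nullity `7` lies on at most `66` five-circuits (coloops are deleted; on a coloop-free core Case 1 gives `44 + 22`, Case 2 the total `63`). -/
theorem ncard_fiveCircuitsThrough_le_sixty_six_of_nullity_seven_aux (n : ℕ) :
    ∀ (M : Matroid α) [M.Finite], M.E.ncard = n →
      (∀ e ∈ M.E, ∃ A ⊆ M.E \ {e}, e ∉ M.closure A ∧ e ∉ M.closure ((M.E \ {e}) \ A)) →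
      (¬ ∃ W ⊆ M.E, W.ncard ≤ 9 ∧ W.encard = M.eRk W + 4) → M.E.encard = M.eRank + 7 → ∀ e : α,
      {C : Set α | M.IsCircuit C ∧ C.ncard = 5 ∧ e ∈ C}.ncard ≤ 66 := by
  induction n using Nat.strong_induction_on with
  | _ n ih =>
    intro M _ hn hfree hns hd e
    by_cases hcol : ∃ s, M.IsColoop s
    · -- delete the coloop: same circuits, same nullity, fewer points
      obtain ⟨s, hs⟩ := hcol
      have hsE : s ∈ M.E := hs.mem_ground
      have hn' : (M ＼ {s}).E.ncard = n - 1 := by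
        rw [Matroid.delete_ground, ncard_sdiff_singleton_of_mem hsE, hn]
      have hlt : n - 1 < n := by
        have : 0 < n := by rw [← hn]; exact (ncard_pos M.ground_finite).2 ⟨s, hsE⟩
        omega
      have h := ih (n - 1) hlt (M ＼ {s}) hn' (S1.hfree_delete M hfree s) (spread_delete M hns s)
        (nullity_delete_singleton_of_isColoop M hs hd) e
      rwa [fiveCircuitsThrough_delete_eq_of_isColoop M hs e] at h
    · -- coloop-free: the solid split with Case 1 `≤ 44 + 22` and Case 2 `≤ 63`
      push Not at hcol
      have h := ncard_fiveCircuitsThrough_le_max_of_planePoor_total M hns hd e 66 63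
        (fun X hX4 heX h7 => by
          have := ncard_fiveCircuitsThrough_le_of_seven_solid_gen_of_nonColoops M 4 hfree hns hd hX4 heX h7
            (fun s _ => hcol s) 44
            (fun M' _ hfree' hns' hd' e' _ => ncard_fiveCircuitsThrough_le_forty_four_of_nullity_six M' hfree' hns' hd' e')
          have hnum : (60 + (4 + 3).choose 4 + 2 * (4 + 2).choose (2 + 1)) / 6 = 22 := by decide
          rw [hnum] at this
          exact this)
        (fun N' _ hpp' hN8' hd' => ncard_fourCircuits_le_sixty_three_of_nullity_seven N' hpp' hN8' hd')
      simpa using h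

/-- **Every point of a spread e-free core of nullity `7` lies on at most `66` five-circuits** (`q₇ ≤ 66`). -/
theorem ncard_fiveCircuitsThrough_le_sixty_six_of_nullity_seven (M : Matroid α) [M.Finite]
    (hfree : ∀ e ∈ M.E, ∃ A ⊆ M.E \ {e}, e ∉ M.closure A ∧ e ∉ M.closure ((M.E \ {e}) \ A))
    (hns : ¬ ∃ W ⊆ M.E, W.ncard ≤ 9 ∧ W.encard = M.eRk W + 4) (hd : M.E.encard = M.eRank + 7) (e : α) :
    {C : Set α | M.IsCircuit C ∧ C.ncard = 5 ∧ e ∈ C}.ncard ≤ 66 :=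
  ncard_fiveCircuitsThrough_le_sixty_six_of_nullity_seven_aux M.E.ncard M rfl hfree hns hd e

end S1

end PercRepro
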